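import Summits.QuantumFields.YangMills.Theses.SqueezedSkewness
import Summits.QuantumFields.YangMills.Theorems.SqueezedSkewnessAntipodalMarkovDictionary
import Summits.QuantumFields.YangMills.Theorems.BalabanLadderNTMarkovMirrorDefect
import Summits.QuantumFields.YangMills.Theorems.BalabanLadderNTReferencePackageScales
import HarnessLib

/-!
# Route `SqueezedSkewness`, glue `AntipodalMarkovGlue` (stmt-QuantumFields-23391) — BY NAME:
# `FloorUnitFBL6 → AntipodalMixing → AntipodalMirrorCeiling`

Planner ym-idea-6 g11, LINE «Markov ceiling» (split of `AntipodalMirrorCeiling` 23202; bears_on R2a /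
stmt-QuantumFields-19353 `BalabanLadder.NT` via the route's `closes`).  The antipodal mirror number
`N_T(⌊T/4⌋) = Cov_T(A_{x₀} ∘ refl, A_{x₀})` (`x₀ = (0⃗, ⌊T/4⌋)`, `T = 2L+1`) is ceilinged by a UV × IR factorisation:

1. DICTIONARY (`…AntipodalMarkovDictionary`): `N = Cov_T(dens z₀ ∘ Θ₀, dens z₀)` in the `torusE` vocabulary, `z₀ = (⌊T/4⌋, 0⃗)`
   (`covF_toFin_reflF`, `toFin_dens_zOf`, `zOf_origin_time`, `sum_ind_mul`).
2. X2 = `MarkovMirror.torusCov_reflect_lift_eq_torusCov_reflect_kerE` on the cube `Q = (z₀ − R, 2R+1)`,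
   `R = ⌊ℓ₁/(4a)⌋`: `N = Cov_T(Φ_Q ∘ Θ₀, Φ_Q)`, `Φ_Q = kerE_Q(dens z₀)` the one-cube boundary response.
3. UV: `FloorUnitFBL6` (fed the M-floor, `Or.inl`) gives `FBL6 G r a`; at the six orientations and depth `d ≥ R+1 > ℓ₁/(4a)`,
   `sup_η |Φ_Q − Σ_q p_q| ≤ 6(C₁+1)/d⁴` (`abs_kerE_dens_sub_le`), so `N = (6(C₁+1)/d⁴)² · Cov_T(F ∘ Θ₀, F)` for the
   NORMALISED response `F = (Φ_Q − Σp)·d⁴/(6(C₁+1))`, `|F| ≤ 1`, continuous, reading only links within sup-distance `R+1`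
   of `z₀` (`mirror_cov_dens_eq_sq_mul_cov`, `cov_affine`).
4. IR: `AntipodalMixing` at radius `ℓ₁`, `b = R + 1`, tolerance `η' = η ℓ₁⁸ / (36 (C₁+1)² 4⁸)`, applied to the transport of
   `F` to the `Fin`-torus (measurable, `|·| ≤ 1`, local by `torusLift_configPerm_symm_apply` / `finLink_fst` and the torus
   distances `min_val_intCast_le`, `min_natAbs_val_intCast_le`): `Cov ≤ η'`, hence `N ≤ η · a⁸`.
Thresholds: `β ≥ max(β₁, β₆, β_a)` with `a(β) ≤ min(ℓ₁/4, 1)` beyond `β_a`; `a(β)·L ≥ max(Λ₆, ℓ₁/2 + 9)` (so `2R + 9 ≤ L`,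
the X2 window `1 ≤ ⌊T/4⌋ − R`, `⌊T/4⌋ + R + 4 ≤ L`).

Fleet lead `ym-spine-19353-p1` g19.  HONEST FRAMING: a kernel-checked REDUCTION; `FloorUnitFBL6` (Bałaban-class boundary law
at a floor-calibrated unit) and `AntipodalMixing` (rate-free antipodal decorrelation) are NOT proved; no summit, rung, crux
`NT` or mass gap follows. [folklore]
-/

set_option autoImplicit false


noncomputable section

open MeasureTheory Filter Topology
open Literature.MathematicalPhysics.QuantumFieldTheory Literature.MathematicalPhysics.QuantumLattice
open Literature.Probability.LatticeModels (Torus.proj Torus.proj_apply)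
open Summit.QuantumFields.YangMills.Cruxes.OSLegsFromFemtoAndGap.DlrCollarTransfer
open Summit.QuantumFields.YangMills.Cruxes.OSLegsFromFemtoAndGap.DlrCollarTransfer.StubLower
  (mem_cubeSites_iff isCylinder_dens exists_abs_dens_le dens_supp_window le_depth_cube)
open Summit.QuantumFields.YangMills.Theorems.OSLegsFromFemtoAndGap.StubLower (integrable_of_continuous_compact)
open Summit.QuantumFields.YangMills.Cruxes.NT.Reference (continuous_kerE eventually_le_of_tendsto div_pow_depth_le)
open Summit.QuantumFields.YangMills.Cruxes.NT.BoundaryLaw (abs_kerE_le)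
open Summit.QuantumFields.YangMills.Cruxes.NT.MarkovMirror

namespace Summit.QuantumFields.YangMills.Theorems.AntipodalMarkovGlue

/-! ## §1 Affine renormalisation inside a covariance -/

/-- `Cov(hX + P, hY + P) = h² Cov(X, Y)` under a probability measure. [folklore] -/
theorem cov_affine {Ω : Type*} [MeasurableSpace Ω] (μ : Measure Ω) [IsProbabilityMeasure μ] {X Y : Ω → ℝ}
    (hX : Integrable X μ) (hY : Integrable Y μ) (hXY : Integrable (fun ω => X ω * Y ω) μ) (h P : ℝ) :
    (∫ ω, (h * X ω + P) * (h * Y ω + P) ∂μ) - (∫ ω, h * X ω + P ∂μ) * (∫ ω, h * Y ω + P ∂μ) =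
      h ^ 2 * ((∫ ω, X ω * Y ω ∂μ) - (∫ ω, X ω ∂μ) * (∫ ω, Y ω ∂μ)) := by
  have e1 : (fun ω => (h * X ω + P) * (h * Y ω + P)) =
      fun ω => h ^ 2 * (X ω * Y ω) + (h * P) * X ω + (h * P) * Y ω + P ^ 2 := by
    funext ω; ring
  have i1 : Integrable (fun ω => h ^ 2 * (X ω * Y ω)) μ := hXY.const_mul _
  have i2 : Integrable (fun ω => (h * P) * X ω) μ := hX.const_mul _
  have i3 : Integrable (fun ω => (h * P) * Y ω) μ := hY.const_mul _
  have i12 : Integrable (fun ω => h ^ 2 * (X ω * Y ω) + (h * P) * X ω) μ := i1.add i2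
  have i123 : Integrable (fun ω => h ^ 2 * (X ω * Y ω) + (h * P) * X ω + (h * P) * Y ω) μ := i12.add i3
  have iX : Integrable (fun ω => h * X ω) μ := hX.const_mul _
  have iY : Integrable (fun ω => h * Y ω) μ := hY.const_mul _
  rw [e1, integral_add i123 (integrable_const _), integral_add i12 i3, integral_add i1 i2,
    integral_add iX (integrable_const P), integral_add iY (integrable_const P)]
  simp only [integral_const_mul, integral_const, probReal_univ, smul_eq_mul, one_mul]
  ring

/-! ## §2 The normalised one-cube boundary response under the plane-resolved boundary law -/

section Response

variable (G : Type) [Group G] [TopologicalSpace G] [IsTopologicalGroup G] [CompactSpace G]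
  [MeasurableSpace G] [BorelSpace G] (r : LatticeRep G)

/-- Kernel linearity: the cube-kernel mean of the action density is the sum of the six plane means. [folklore] -/
theorem kerE_dens_eq_sum_plane (β : ℝ) (c : Fin 4 → ℤ) (b : ℕ) (η : LGConfig 4 G) (z : Fin 4 → ℤ) :
    kerE G r β c b η (dens G r z) = ∑ q : {q : Fin 4 × Fin 4 // q.1 < q.2}, kerE G r β c b η (plane G r q.1 z) := by
  have h := kerE_finset_sum_mul G r β c b η Finset.univ (fun _ => (1 : ℝ))
    (fun q : {q : Fin 4 × Fin 4 // q.1 < q.2} => plane G r q.1 z) fun q _ => continuous_plane r _ _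
  simp only [one_mul] at h
  rw [← h]
  congr 1
  funext V
  exact dens_eq_sum_subtype_plane G r z V

/-- **Size of the boundary response from the plane-resolved law.**  If every plane mean at `z` is within `C₁/d⁴`
of its reference value, the density mean is within `6 (C₁+1)/d⁴` of the summed reference value, for every
exterior. [folklore] -/
theorem abs_kerE_dens_sub_le (β : ℝ) (c : Fin 4 → ℤ) (b : ℕ) (z : Fin 4 → ℤ) {C₁ : ℝ} {d : ℝ} (hd : 0 < d)
    (p : Fin 4 × Fin 4 → ℝ)
    (hB : ∀ (η : LGConfig 4 G) (q : Fin 4 × Fin 4), q.1 < q.2 → |kerE G r β c b η (plane G r q z) - p q| ≤ C₁ / d ^ 4)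
    (η : LGConfig 4 G) :
    |kerE G r β c b η (dens G r z) - ∑ q : {q : Fin 4 × Fin 4 // q.1 < q.2}, p q.1| ≤ 6 * (C₁ + 1) / d ^ 4 := by
  rw [kerE_dens_eq_sum_plane, ← Finset.sum_sub_distrib]
  refine (Finset.abs_sum_le_sum_abs _ _).trans ?_
  have hq : ∀ q ∈ (Finset.univ : Finset {q : Fin 4 × Fin 4 // q.1 < q.2}),
      |kerE G r β c b η (plane G r q.1 z) - p q.1| ≤ (C₁ + 1) / d ^ 4 := fun q _ =>
    (hB η q.1 q.2).trans (div_le_div_of_nonneg_right (by linarith) (by positivity))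
  refine (Finset.sum_le_sum hq).trans ?_
  rw [Finset.sum_const, Finset.card_univ, show Fintype.card {q : Fin 4 × Fin 4 // q.1 < q.2} = 6 by decide,
    nsmul_eq_mul]
  norm_num
  exact le_of_eq (by ring)

/-- **The torus-side core of the Markov ceiling.**  Cube `Q = (z₀ − R, 2R+1)` around `z₀` at times `≥ 1` inside the
odd torus `2L+1` (window hypotheses of X2), and the plane-resolved boundary law at `z₀` with constant `C₁/d⁴`,
`d = depth_Q(z₀)`.  Then there is a continuous observable `Φ`, `|Φ| ≤ 1`, reading only links based in the window
`[z₀ − R − 1, z₀ + R + 1]` (the NORMALISED boundary response `(kerE_Q(dens z₀) − Σ_q p_q)·d⁴/(6(C₁+1))`), with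
`Cov_T(dens z₀ ∘ Θ₀, dens z₀) = (6(C₁+1)/d⁴)² · Cov_T(Φ ∘ Θ₀, Φ)`:
the Markov mirror identity X2 (`torusCov_reflect_lift_eq_torusCov_reflect_kerE`) followed by the affine
renormalisation of the one-cube boundary response. [folklore] -/
theorem mirror_cov_dens_eq_sq_mul_cov (β : ℝ) (z₀ : Fin 4 → ℤ) (R L : ℕ) (hR : 1 ≤ R)
    (hc0 : 1 ≤ z₀ 0 - R) (hcL : z₀ 0 + R + 4 ≤ L) (hc : ∀ j, -(L : ℤ) + 2 ≤ z₀ j - R ∧ z₀ j + R + 2 ≤ L)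
    {C₁ : ℝ} (hC₁ : 0 ≤ C₁) (p : Fin 4 × Fin 4 → ℝ)
    (hB : ∀ (η : LGConfig 4 G) (q : Fin 4 × Fin 4), q.1 < q.2 →
      |kerE G r β (fun j => z₀ j - R) (2 * R + 1) η (plane G r q z₀) - p q| ≤
        C₁ / (depth (fun j => z₀ j - R) (2 * R + 1) z₀ : ℝ) ^ 4) :
    ∃ Φ : LGConfig 4 G → ℝ, Continuous Φ ∧ (∀ U, |Φ U| ≤ 1) ∧
      (∀ U V : LGConfig 4 G, (∀ e : Literature.MathematicalPhysics.QuantumLattice.ZdEdge 4,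
          (∀ j, z₀ j - R - 1 ≤ e.1 j ∧ e.1 j ≤ z₀ j + R + 1) → U e = V e) → Φ U = Φ V) ∧
      torusE G r β L (fun V => dens G r z₀ (cfgReflect V) * dens G r z₀ V) -
          torusE G r β L (fun V => dens G r z₀ (cfgReflect V)) * torusE G r β L (dens G r z₀) =
        (6 * (C₁ + 1) / (depth (fun j => z₀ j - R) (2 * R + 1) z₀ : ℝ) ^ 4) ^ 2 *
          (torusE G r β L (fun V => Φ (cfgReflect V) * Φ V) -
            torusE G r β L (fun V => Φ (cfgReflect V)) * torusE G r β L Φ) := by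
  haveI := r.secondCountableTopology
  -- notation
  set c : Fin 4 → ℤ := fun j => z₀ j - R with hc_def
  set b : ℕ := 2 * R + 1 with hb_def
  set d : ℝ := (depth c b z₀ : ℝ) with hd_def
  set P : ℝ := ∑ q : {q : Fin 4 × Fin 4 // q.1 < q.2}, p q.1 with hP_def
  set h : ℝ := 6 * (C₁ + 1) / d ^ 4 with hh_def
  -- depth and positivity
  have hdR : (R : ℝ) + 1 ≤ d := by
    have := le_depth_cube z₀ z₀ R (t := 0) (fun j => by simp)
    simpa [hd_def, hc_def, hb_def] using this
  have hR1 : (1 : ℝ) ≤ R := by exact_mod_cast hR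
  have hd0 : 0 < d := by linarith
  have hh0 : 0 < h := by rw [hh_def]; positivity
  -- the action density at z₀: continuity, bound, support
  obtain ⟨M, -, hM⟩ := exists_abs_dens_le G r
  have hFc : Continuous (dens G r z₀) := continuous_dens r z₀
  have hzz : ∀ j, |z₀ j - z₀ j| + 1 ≤ (R : ℤ) := fun j => by simp; exact_mod_cast hR
  have hW : ∀ e ∈ r.curvature.supp.image (fun e => (e.1 + z₀, e.2)), ∀ j, c j ≤ e.1 j ∧ e.1 j ≤ c j + b := by
    intro e he j
    have := dens_supp_window G r z₀ z₀ R hzz e he j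
    simp only [hc_def, hb_def]; push_cast
    constructor <;> linarith [this.1, this.2]
  -- X2
  have hX2 := torusCov_reflect_lift_eq_torusCov_reflect_kerE G r β c b L (by simpa [hc_def] using hc0)
    (by simp only [hc_def, hb_def]; push_cast; linarith)
    (fun j => ⟨by simpa [hc_def] using (hc j).1, by simp only [hc_def, hb_def]; push_cast; linarith [(hc j).2]⟩)
    hFc hFc (hM z₀) (hM z₀) (isCylinder_dens G r z₀) (isCylinder_dens G r z₀) hW hW
  -- the normalised response
  set K : LGConfig 4 G → ℝ := fun η => kerE G r β c b η (dens G r z₀) with hK_def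
  refine ⟨fun η => (K η - P) / h, ?_, ?_, ?_, ?_⟩
  · exact ((continuous_kerE G r β c b hFc (hM z₀)).sub continuous_const).div_const _
  · intro η
    rw [abs_div, abs_of_pos hh0, div_le_one hh0]
    exact abs_kerE_dens_sub_le G r β c b z₀ hd0 p hB η
  · intro U V hUV
    have hcyl := isCylinder_kerE G r β c b hFc.measurable (isCylinder_dens G r z₀)
    have : K U = K V := hcyl fun e he => hUV e fun j => by
      have := kerE_supp_window hW (Finset.mem_coe.1 he) j
      simp only [hc_def, hb_def] at this; push_cast at this
      constructor <;> linarith [this.1, this.2]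
    simp only [this]
  · have hK : ∀ η, K η = h * ((K η - P) / h) + P := fun η => by field_simp; ring
    have hΦc : Continuous fun η => (K η - P) / h :=
      ((continuous_kerE G r β c b hFc (hM z₀)).sub continuous_const).div_const _
    haveI := isProbabilityMeasure_wilsonMeasure (d := 4) (L := 2 * L + 1) r.ρ r.continuous β
    have iX : Integrable (fun U : GaugeConfig 4 (2 * L + 1) G => (K (cfgReflect (torusLift (2 * L + 1) U)) - P) / h)
        (wilsonMeasure (d := 4) (L := 2 * L + 1) r.ρ β) :=
      integrable_of_continuous_compact ((hΦc.comp continuous_cfgReflect).comp (continuous_torusLift _))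
    have iY : Integrable (fun U : GaugeConfig 4 (2 * L + 1) G => (K (torusLift (2 * L + 1) U) - P) / h)
        (wilsonMeasure (d := 4) (L := 2 * L + 1) r.ρ β) :=
      integrable_of_continuous_compact (hΦc.comp (continuous_torusLift _))
    have iXY : Integrable (fun U : GaugeConfig 4 (2 * L + 1) G =>
        (K (cfgReflect (torusLift (2 * L + 1) U)) - P) / h * ((K (torusLift (2 * L + 1) U) - P) / h))
        (wilsonMeasure (d := 4) (L := 2 * L + 1) r.ρ β) :=
      integrable_of_continuous_compact (((hΦc.comp continuous_cfgReflect).comp (continuous_torusLift _)).mul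
        (hΦc.comp (continuous_torusLift _)))
    rw [hX2]
    unfold torusE
    have e1 : (fun U : GaugeConfig 4 (2 * L + 1) G =>
        kerE G r β c b (cfgReflect (torusLift (2 * L + 1) U)) (dens G r z₀) *
          kerE G r β c b (torusLift (2 * L + 1) U) (dens G r z₀)) =
        fun U => (h * ((K (cfgReflect (torusLift (2 * L + 1) U)) - P) / h) + P) *
          (h * ((K (torusLift (2 * L + 1) U) - P) / h) + P) := by
      funext U; rw [← hK, ← hK]
    have e2 : (fun U : GaugeConfig 4 (2 * L + 1) G => kerE G r β c b (cfgReflect (torusLift (2 * L + 1) U)) (dens G r z₀)) =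
        fun U => h * ((K (cfgReflect (torusLift (2 * L + 1) U)) - P) / h) + P := by
      funext U; rw [← hK]
    have e3 : (fun U : GaugeConfig 4 (2 * L + 1) G => kerE G r β c b (torusLift (2 * L + 1) U) (dens G r z₀)) =
        fun U => h * ((K (torusLift (2 * L + 1) U) - P) / h) + P := by
      funext U; rw [← hK]
    rw [e1, e2, e3, cov_affine _ iX iY iXY h P]

end Response


/-! ## §3 The glue `FloorUnitFBL6 → AntipodalMixing → AntipodalMirrorCeiling` -/

section Assembly

open Summit.QuantumFields.YangMills.Theorems.ThermalDescentTorusDictionary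
open Summit.QuantumFields.YangMills.Theorems.AntipodalMarkovDictionary

/-- The indicator of the site `(0⃗, t)` picks one term of a site sum. [folklore] -/
theorem sum_ind_mul (L t : ℕ) (ht : t < 2 * L + 1)
    (g : FinTorusSite (2 * L + 1) (2 * L + 1) (2 * L + 1) (2 * L + 1) → ℝ) :
    ∑ x : FinTorusSite (2 * L + 1) (2 * L + 1) (2 * L + 1) (2 * L + 1),
        (if x.2.2.2.val = t ∧ x.1.val = 0 ∧ x.2.1.val = 0 ∧ x.2.2.1.val = 0 then (1 : ℝ) else 0) * g x =
      g ((0 : Fin (2 * L + 1)), (0 : Fin (2 * L + 1)), (0 : Fin (2 * L + 1)), (⟨t, ht⟩ : Fin (2 * L + 1))) := by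
  rw [Finset.sum_eq_single ((0 : Fin (2 * L + 1)), (0 : Fin (2 * L + 1)), (0 : Fin (2 * L + 1)), (⟨t, ht⟩ : Fin (2 * L + 1)))]
  · simp
  · intro x _ hx
    rw [if_neg, zero_mul]
    rintro ⟨h1, h2, h3, h4⟩
    apply hx
    obtain ⟨x1, x2, x3, x4⟩ := x
    simp only [Prod.mk.injEq]
    refine ⟨Fin.ext h2, Fin.ext h3, Fin.ext h4, Fin.ext h1⟩
  · intro h; exact absurd (Finset.mem_univ _) h

/-- The `ℤ⁴` site (time first, centred coordinates) of the `Fin`-site `(0⃗, t)`, `2t < T`. [folklore] -/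
theorem zOf_origin_time (L t : ℕ) (ht : t < 2 * L + 1) (h2t : 2 * t < 2 * L + 1) :
    zOf (2 * L + 1) ((0 : Fin (2 * L + 1)), (0 : Fin (2 * L + 1)), (0 : Fin (2 * L + 1)), (⟨t, ht⟩ : Fin (2 * L + 1))) =
      ![(t : ℤ), 0, 0, 0] := by
  have h0 : ccZ (2 * L + 1) (0 : Fin (2 * L + 1)) = 0 := by simp [ccZ]
  have h1 : ccZ (2 * L + 1) (⟨t, ht⟩ : Fin (2 * L + 1)) = t := by simp [ccZ, h2t]
  simp only [zOf, h0, h1]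

/-- **`AntipodalMarkovGlue`** (item stmt-QuantumFields-23391), BY NAME: `FloorUnitFBL6 → AntipodalMixing →
AntipodalMirrorCeiling`. [folklore] -/
theorem antipodalMarkovGlue_proof :
    Summit.QuantumFields.YangMills.Theses.SqueezedSkewness.AntipodalMarkovGlue := by
  intro h1 h2 G _ _ _ _ hG r a ha ha0
  letI : MeasurableSpace G := borel G
  haveI : BorelSpace G := ⟨rfl⟩
  haveI := r.secondCountableTopology
  have hF6 := h1 G hG r a ha ha0
  have hMix := h2 G hG r a ha ha0
  dsimp only at hF6 hMix ⊢
  intro hfl η hη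
  have hF : FBL6 G r a := hF6 (Or.inl hfl)
  clear hF6
  obtain ⟨C₁, β₁, ℓ₁, p, hℓ₁, hC₁, hB⟩ := hF
  -- tolerance for the mixing input, and the `a`-smallness threshold
  set η' : ℝ := η * ℓ₁ ^ 8 / (36 * (C₁ + 1) ^ 2 * 4 ^ 8) with hη'
  have hη'0 : 0 < η' := by rw [hη']; positivity
  obtain ⟨β₆, Λ₆, hmix⟩ := hMix ℓ₁ η' hℓ₁ hη'0
  clear hMix
  obtain ⟨βa, hβa⟩ := eventually_le_of_tendsto ha0 (δ := min (ℓ₁ / 4) 1) (lt_min (by positivity) one_pos)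
  refine ⟨max (max β₁ β₆) βa, max Λ₆ (ℓ₁ / 2 + 9), fun β hβ L hL => ?_⟩
  have hβ₁ : β₁ ≤ β := le_trans (le_max_left _ _) (le_trans (le_max_left _ _) hβ)
  have hβ₆ : β₆ ≤ β := le_trans (le_max_right _ _) (le_trans (le_max_left _ _) hβ)
  have hs : 0 < a β := ha β
  have hsℓ : a β ≤ ℓ₁ / 4 := (hβa β (le_trans (le_max_right _ _) hβ)).trans (min_le_left _ _)
  have hs1 : a β ≤ 1 := (hβa β (le_trans (le_max_right _ _) hβ)).trans (min_le_right _ _)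
  have hLΛ : Λ₆ ≤ a β * L := (le_max_left _ _).trans hL
  have hL9 : ℓ₁ / 2 + 9 ≤ a β * L := (le_max_right _ _).trans hL
  -- the femto radius `R = ⌊ℓ₁ / 4a⌋`
  obtain ⟨R, hRdef⟩ : ∃ R : ℕ, R = ⌊ℓ₁ / (4 * a β)⌋₊ := ⟨_, rfl⟩
  have h4a : 0 < 4 * a β := by positivity
  have hR1 : 1 ≤ R := by
    rw [hRdef]
    refine Nat.le_floor ?_
    rw [Nat.cast_one, le_div_iff₀ h4a]
    linarith
  have hR1r : (1 : ℝ) ≤ R := by exact_mod_cast hR1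
  have hRle : (R : ℝ) ≤ ℓ₁ / (4 * a β) := by rw [hRdef]; exact Nat.floor_le (by positivity)
  have hRlt : ℓ₁ / (4 * a β) < R + 1 := by rw [hRdef]; exact Nat.lt_floor_add_one _
  have hRs : (R : ℝ) * a β ≤ ℓ₁ / 4 := by
    rw [le_div_iff₀ h4a] at hRle
    linarith
  -- integer window on the torus of side `2L+1`: `2R + 9 ≤ L`
  have hL' : 2 * R + 9 ≤ L := by
    have h1 : ((2 * R + 9 : ℕ) : ℝ) * a β ≤ (L : ℝ) * a β := by
      push_cast
      nlinarith
    have h2 : ((2 * R + 9 : ℕ) : ℝ) ≤ (L : ℝ) := le_of_mul_le_mul_right h1 hs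
    exact_mod_cast h2
  -- the mirror site `z₀ = (h₀, 0⃗)`, `h₀ = ⌊T/4⌋`
  obtain ⟨h₀, hh₀⟩ : ∃ h₀ : ℕ, h₀ = (2 * L + 1) / 4 := ⟨_, rfl⟩
  have hh₀T : h₀ < 2 * L + 1 := by omega
  have hh₀2 : 2 * h₀ < 2 * L + 1 := by omega
  have hRh : R + 1 ≤ h₀ := by omega
  have hhL : h₀ + R + 4 ≤ L := by omega
  set z₀ : Fin 4 → ℤ := ![(h₀ : ℤ), 0, 0, 0] with hz₀
  have hz₀0 : z₀ 0 = h₀ := by simp [hz₀]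
  have hc0 : 1 ≤ z₀ 0 - R := by rw [hz₀0]; omega
  have hcL : z₀ 0 + R + 4 ≤ L := by rw [hz₀0]; omega
  have hc : ∀ j, -(L : ℤ) + 2 ≤ z₀ j - R ∧ z₀ j + R + 2 ≤ L := by
    intro j
    fin_cases j <;> simp [hz₀] <;> omega
  -- the plane-resolved boundary law on the cube `(z₀ − R, 2R+1)` at `z₀`
  have hbs : ((2 * R + 1 : ℕ) : ℝ) * a β ≤ ℓ₁ := by push_cast; nlinarith
  have hdR : (R : ℝ) + 1 ≤ (depth (fun j => z₀ j - R) (2 * R + 1) z₀ : ℝ) := by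
    have := le_depth_cube z₀ z₀ R (t := 0) (fun j => by simp)
    simpa using this
  have hdepth : 2 ≤ depth (fun j => z₀ j - R) (2 * R + 1) z₀ := by
    have : (2 : ℝ) ≤ (depth (fun j => z₀ j - R) (2 * R + 1) z₀ : ℝ) := by linarith
    exact_mod_cast this
  have hB' : ∀ (ζ : LGConfig 4 G) (q : Fin 4 × Fin 4), q.1 < q.2 →
      |kerE G r β (fun j => z₀ j - R) (2 * R + 1) ζ (plane G r q z₀) - p q β| ≤
        C₁ / (depth (fun j => z₀ j - R) (2 * R + 1) z₀ : ℝ) ^ 4 :=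
    fun ζ q hq => hB β hβ₁ _ _ hbs ζ q z₀ hq hdepth
  obtain ⟨Φ, hΦc, hΦb, hΦloc, hcov⟩ :=
    mirror_cov_dens_eq_sq_mul_cov G r β z₀ R L hR1 hc0 hcL hc hC₁ (fun q => p q β) hB'
  -- the normalised response on the `Fin`-torus satisfies the hypotheses of `AntipodalMixing`
  have hFm : Measurable (fun V : FinTorusSite (2 * L + 1) (2 * L + 1) (2 * L + 1) (2 * L + 1) × Fin 4 → G =>
      Φ (torusLift (2 * L + 1) (configPerm (finRotate 4) ((finTorusConfigEquivSite G (2 * L + 1)).symm V)))) :=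
    measurable_toFin hΦc.measurable
  have hFb : ∀ V : FinTorusSite (2 * L + 1) (2 * L + 1) (2 * L + 1) (2 * L + 1) × Fin 4 → G,
      |Φ (torusLift (2 * L + 1) (configPerm (finRotate 4) ((finTorusConfigEquivSite G (2 * L + 1)).symm V)))| ≤ 1 := fun V => hΦb _
  have hR1s : ((R + 1 : ℕ) : ℝ) * a β ≤ ℓ₁ := by push_cast; nlinarith
  have hFloc : ∀ U U' : FinTorusSite (2 * L + 1) (2 * L + 1) (2 * L + 1) (2 * L + 1) × Fin 4 → G,
      (∀ e : FinTorusSite (2 * L + 1) (2 * L + 1) (2 * L + 1) (2 * L + 1) × Fin 4,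
        (min e.1.1.val (2 * L + 1 - e.1.1.val) ≤ R + 1 ∧ min e.1.2.1.val (2 * L + 1 - e.1.2.1.val) ≤ R + 1 ∧
          min e.1.2.2.1.val (2 * L + 1 - e.1.2.2.1.val) ≤ R + 1 ∧
          min (Int.natAbs ((e.1.2.2.2.val : ℤ) - ((2 * L + 1) / 4 : ℕ)))
            (2 * L + 1 - Int.natAbs ((e.1.2.2.2.val : ℤ) - ((2 * L + 1) / 4 : ℕ))) ≤ R + 1) → U e = U' e) →
      Φ (torusLift (2 * L + 1) (configPerm (finRotate 4) ((finTorusConfigEquivSite G (2 * L + 1)).symm U))) = Φ (torusLift (2 * L + 1) (configPerm (finRotate 4) ((finTorusConfigEquivSite G (2 * L + 1)).symm U'))) := by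
    intro U U' hUU'
    refine hΦloc _ _ fun e he => ?_
    rw [torusLift_configPerm_symm_apply, torusLift_configPerm_symm_apply]
    apply hUU'
    rw [finLink_fst]
    dsimp only
    have he0 := he 0
    have he1 := he 1
    have he2 := he 2
    have he3 := he 3
    simp only [hz₀, Matrix.cons_val_zero, Matrix.cons_val_one, Matrix.cons_val] at he0 he1 he2 he3
    refine ⟨min_val_intCast_le L (m := R + 1) (abs_le.2 ⟨by push_cast; omega, by push_cast; omega⟩) (by omega),
      min_val_intCast_le L (m := R + 1) (abs_le.2 ⟨by push_cast; omega, by push_cast; omega⟩) (by omega),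
      min_val_intCast_le L (m := R + 1) (abs_le.2 ⟨by push_cast; omega, by push_cast; omega⟩) (by omega),
      ?_⟩
    rw [← hh₀]
    exact min_natAbs_val_intCast_le L (m := R + 1) (by omega) (by omega) (abs_le.2 ⟨by push_cast; omega, by push_cast; omega⟩)
  have hmix' := hmix β hβ₆ L hLΛ (R + 1) hR1s _ hFm hFb hFloc
  clear hmix hFloc hFm hFb
  -- the size of the response
  have hd' : ℓ₁ / 4 / a β ≤ (depth (fun j => z₀ j - R) (2 * R + 1) z₀ : ℝ) := by
    rw [div_div]; linarith
  have hh' : 6 * (C₁ + 1) / (depth (fun j => z₀ j - R) (2 * R + 1) z₀ : ℝ) ^ 4 ≤ 6 * (C₁ + 1) * (a β / (ℓ₁ / 4)) ^ 4 :=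
    div_pow_depth_le (by positivity) (by positivity) hs hd'
  have hh'0 : 0 ≤ 6 * (C₁ + 1) / (depth (fun j => z₀ j - R) (2 * R + 1) z₀ : ℝ) ^ 4 := by positivity
  have hfin : (6 * (C₁ + 1) / (depth (fun j => z₀ j - R) (2 * R + 1) z₀ : ℝ) ^ 4) ^ 2 * η' ≤ η * a β ^ 8 := by
    calc (6 * (C₁ + 1) / (depth (fun j => z₀ j - R) (2 * R + 1) z₀ : ℝ) ^ 4) ^ 2 * η'
        ≤ (6 * (C₁ + 1) * (a β / (ℓ₁ / 4)) ^ 4) ^ 2 * η' :=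
          mul_le_mul_of_nonneg_right (pow_le_pow_left₀ hh'0 hh' 2) hη'0.le
      _ = η * a β ^ 8 := by rw [hη']; field_simp; ring
  -- assembly
  have key : eF r β (2 * L + 1) (fun U => (∑ x, (if x.2.2.2.val = (2 * L + 1) / 4 ∧ x.1.val = 0 ∧ x.2.1.val = 0 ∧
        x.2.2.1.val = 0 then (1 : ℝ) else 0) * aF r x (fun e => if e.2 = Fin.last 3 then (U ((e.1.1, e.1.2.1, e.1.2.2.1, Fin.rev e.1.2.2.2), Fin.last 3))⁻¹ else U ((e.1.1, e.1.2.1, e.1.2.2.1, ⟨((2 * L + 1) - e.1.2.2.2.val) % (2 * L + 1), Nat.mod_lt _ e.1.2.2.2.pos⟩), e.2))) *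
        ∑ x, (if x.2.2.2.val = (2 * L + 1) / 4 ∧ x.1.val = 0 ∧ x.2.1.val = 0 ∧ x.2.2.1.val = 0 then (1 : ℝ) else 0) *
          aF r x U) -
      eF r β (2 * L + 1) (fun U => ∑ x, (if x.2.2.2.val = (2 * L + 1) / 4 ∧ x.1.val = 0 ∧ x.2.1.val = 0 ∧
        x.2.2.1.val = 0 then (1 : ℝ) else 0) * aF r x (fun e => if e.2 = Fin.last 3 then (U ((e.1.1, e.1.2.1, e.1.2.2.1, Fin.rev e.1.2.2.2), Fin.last 3))⁻¹ else U ((e.1.1, e.1.2.1, e.1.2.2.1, ⟨((2 * L + 1) - e.1.2.2.2.val) % (2 * L + 1), Nat.mod_lt _ e.1.2.2.2.pos⟩), e.2))) *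
      eF r β (2 * L + 1) (fun U => ∑ x, (if x.2.2.2.val = (2 * L + 1) / 4 ∧ x.1.val = 0 ∧ x.2.1.val = 0 ∧
        x.2.2.1.val = 0 then (1 : ℝ) else 0) * aF r x U) ≤ η * a β ^ 8 := by
    simp_rw [sum_ind_mul L ((2 * L + 1) / 4) (hh₀ ▸ hh₀T)]
    rw [← toFin_dens_zOf (G := G) r L, zOf_origin_time L _ (hh₀ ▸ hh₀T) (hh₀ ▸ hh₀2)]
    simp only []
    rw [show (![(((2 * L + 1) / 4 : ℕ) : ℤ), 0, 0, 0] : Fin 4 → ℤ) = z₀ by rw [hz₀, hh₀], covF_toFin_reflF, hcov,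
      ← covF_toFin_reflF (G := G) r β L Φ Φ]
    exact (mul_le_mul_of_nonneg_left hmix' (sq_nonneg _)).trans hfin
  exact key

end Assembly

end Summit.QuantumFields.YangMills.Theorems.AntipodalMarkovGlue

end
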